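import Literature.NumberTheory.ComplexMultiplication.CMTypeUniformization
import Literature.NumberTheory.NumberFields.IdeleActionOnIdealQuotients
import Literature.AlgebraicGeometry.HodgeTheory.AbelianVarietyTorsionPointsSeparate
import HarnessLib

/-!
# A homomorphism out of a uniformised CM abelian variety is determined on the torsion parametrisation `r(K/𝔞)`
# (Shimura 1998, §21.4: «since `r(w)^σ = λ(r(cw))`, `λ` is also uniquely determined by `σ`»)

For a complex abelian variety `A` with `ι : 𝔬_K → End A` uniformised by `ξ : ℂ^Φ/D(𝔞) → A(ℂ)` of type
`(K, Φ, 𝔞)` (`CMTypeUniformization`, Shimura (18.4a)), Shimura's torsion parametrisation `r = ξ ∘ q : K → A(ℂ)`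
exhausts the points of finite order (`CMTypeUniformization.mem_torsionPoints_iff_exists_r_eq`, §17.1 «the module
`K/𝔞` … corresponds to the group of all points of finite order»), and torsion points separate homomorphisms of
complex abelian varieties (`AbelianVariety.hom_ext_of_forall_torsionPoints`, Mumford §4 + density).  Hence:

* `CMTypeUniformization.hom_ext_of_forall_r` — two homomorphisms `f, g : A → B` with `f(r(v)) = g(r(v))` for all
  `v ∈ K` are equal;
* `CMTypeUniformization.hom_ext_of_forall_ideleMulEquiv` — the form used in the proof of Thm. 21.4: if `f` and `g`
  both satisfy «`Q(u) = f(r(v))` whenever `t·(u mod 𝔞) = v (mod t𝔞)`» (Shimura's (18.3a), `IdeleAction.ideleMulEquiv`)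
  for one and the same family of prescribed values `Q : K → B(ℂ)` — in the application `Q(u) = r(u)^σ`, `B = A^σ`,
  `t = c_σ = β(y)f(y)⁻¹` — then `f = g`: **the isomorphism `λ_σ : A → A^σ` with `r(u)^σ = λ_σ(r(c_σ u))` is unique**,
  the step «`λ` is also uniquely determined by `σ`» of Shimura's proof (pp. 147–148), from which the cocycle rule
  `λ_{στ} = λ_σ^τ λ_τ` follows.  No hypothesis `t𝔞 = 𝔞` is needed (surjectivity of `ideleMulEquiv` suffices).

Everything is proved; no definition, no named fact.  Cell `hodgecm-mathlib`, line `a2b-twisted-galois-model`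
(support lemma U2 for `stub_twistedModelOfFiniteLevel` / `stub_finiteLevelReciprocity`).

## References

* [Shimura1998] G. Shimura, *Abelian Varieties with Complex Multiplication and Modular Functions* (1998), §21.4
  proof of Thm. 21.4, pp. 147–148; §17.1 p. 118; §18.3 (18.3a) p. 122.
* [MumfordAV1970] D. Mumford, *Abelian Varieties* (1970), §4.
-/

noncomputable section

open scoped nonZeroDivisors NumberField
open CategoryTheory NumberField

namespace Literature.NumberTheory.ComplexMultiplication

open Literature.AlgebraicGeometry.Motives (CMType AbelianVariety AlgPoints)
open Literature.NumberTheory.NumberFields.IdeleAction (ideleMulIdeal ideleMulEquiv)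

namespace CMTypeUniformization

variable {K : Type} [Field K] [NumberField K] {Φ : CMType K} {𝔞 : (FractionalIdeal (𝓞 K)⁰ K)ˣ}
  {A B : AbelianVariety ℂ} {ι : 𝓞 K →+* End A} (ξ : CMTypeUniformization Φ 𝔞 A ι)

/-- **A homomorphism out of a uniformised `(A, ι)` is determined by its values on `r(K)`**: if
`f(r(v)) = g(r(v))` for every `v ∈ K` then `f = g` (`r(K/𝔞)` is the set of all torsion points of `A(ℂ)`, and
torsion points separate homomorphisms of complex abelian varieties).
[cite: Shimura1998, §21.4, proof of Thm. 21.4, pp. 147–148] [cite: MumfordAV1970, §4] -/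
theorem hom_ext_of_forall_r {f g : A ⟶ B}
    (h : ∀ v : K, AlgPoints.map f.hom.hom.hom (ξ.r v) = AlgPoints.map g.hom.hom.hom (ξ.r v)) : f = g := by
  refine AbelianVariety.hom_ext_of_forall_torsionPoints fun n hn P hP ↦ ?_
  obtain ⟨v, -, rfl⟩ := ξ.exists_r_eq_of_mem_torsionPoints (Nat.pos_iff_ne_zero.mp hn) hP
  exact h v

/-- **«`λ` is uniquely determined by `σ`»** (Shimura pp. 147–148): for a finite idèle `t` of `K` and prescribed
values `Q : K → B(ℂ)`, AT MOST ONE homomorphism `f : A → B` satisfies «`Q(u) = f(r(v))` whenever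
`t·(u mod 𝔞) = v (mod t𝔞)`» ((18.3a), `IdeleAction.ideleMulEquiv`) — every class mod `t𝔞` is hit, and `f` is
determined on `r(K)`.  In the proof of Thm. 21.4, `B = A^σ`, `Q(u) = r(u)^σ`, `t = β(y)f(y)⁻¹`, `f = λ_σ`.
[cite: Shimura1998, §21.4, proof of Thm. 21.4, pp. 147–148; §18.3 (18.3a) p. 122] -/
theorem hom_ext_of_forall_ideleMulEquiv (t : (IsDedekindDomain.FiniteAdeleRing (𝓞 K) K)ˣ) (Q : K → B.Points ℂ)
    {f g : A ⟶ B}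
    (hf : ∀ u v : K, ideleMulEquiv t (𝔞 : FractionalIdeal (𝓞 K)⁰ K) 𝔞.ne_zero (Submodule.Quotient.mk u) =
        Submodule.Quotient.mk v → Q u = AlgPoints.map f.hom.hom.hom (ξ.r v))
    (hg : ∀ u v : K, ideleMulEquiv t (𝔞 : FractionalIdeal (𝓞 K)⁰ K) 𝔞.ne_zero (Submodule.Quotient.mk u) =
        Submodule.Quotient.mk v → Q u = AlgPoints.map g.hom.hom.hom (ξ.r v)) : f = g := by
  refine ξ.hom_ext_of_forall_r fun v ↦ ?_
  -- a preimage `u mod 𝔞` of `v mod t𝔞` under the bijection (18.3a)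
  obtain ⟨u, hu⟩ := Submodule.Quotient.mk_surjective _
    ((ideleMulEquiv t (𝔞 : FractionalIdeal (𝓞 K)⁰ K) 𝔞.ne_zero).symm (Submodule.Quotient.mk v))
  have huv : ideleMulEquiv t (𝔞 : FractionalIdeal (𝓞 K)⁰ K) 𝔞.ne_zero (Submodule.Quotient.mk u) =
      Submodule.Quotient.mk v := by
    rw [hu, LinearEquiv.apply_symm_apply]
  rw [← hf u v huv, ← hg u v huv]

end CMTypeUniformization

end Literature.NumberTheory.ComplexMultiplication

end
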